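import Literature.NumberTheory.EllipticCurves.TateModule
import Literature.NumberTheory.EllipticCurves.IsogenyNotRationalCMProofs
import Summits.BirchSwinnertonDyer.BirchSwinnertonDyer.Theorems.PrintCf2SplitBadTwoCMEigenDecomposition
import Summits.BirchSwinnertonDyer.BirchSwinnertonDyer.Theorems.PrintCf2SplitBadTwoCMEndomorphismSqrtMinusSeven
import HarnessLib

/-!
# Crux `PrintCf2.SplitBadTwoRankOneOfFacts` (item stmt-BirchSwinnertonDyer-20368), road α over the CM field:
# the CM-prime decomposition OVER `ℚ̄` and the COMPLEX-CONJUGATION SWAP `E[𝔭^∞] ↔ E[𝔭̄^∞]`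

Cell `bsd-print-cf2`, width seat `bsd-line-cf2-p1-w2` g7; `--supports stmt-BirchSwinnertonDyer-20368` (helper); sequel of p643651 /
p643722 / p644268. HONEST FRAMING: nothing here closes a crux or a stub; BSD is not proved by any of this; no summit statement is proved
by this seat. No definition is introduced.

Over `ℚ` the complex multiplication `π = [(1+√−7)/2]` of a curve with `j = −3375` is NOT rational (`√−7 ∉ ℚ`; the tree's
`not_hasRationalCM_holds`, Silverman *AT* II.2.2): every `σ ∈ Γ_ℚ` either commutes with `π` (`σ` fixes `√−7`) or conjugates it to
`π̄ = 1 − π` (`σ` moves `√−7`), and the second kind EXISTS. Accordingly the two eigen-summands `C₁ = E[𝔭^∞]`, `C₂ = E[𝔭̄^∞]` of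
`E[2^∞](ℚ̄)` are preserved by the `σ` of the first kind and INTERCHANGED by those of the second kind (complex conjugation swaps `𝔭`
and `𝔭̄`). This is the symmetry behind `#Ш(E/K₀)[𝔭^∞] = #Ш(E/K₀)[𝔭̄^∞]` and behind «the line at `v̄` is the conjugate of the line at
`v`» on road α.

* `cmEndo_not_mem_endRing_rat` — `π ∉ End_ℚ(E)`; `exists_conj_cmEndo_eq_one_sub` — some `σ ∈ Γ_ℚ` has `σπσ⁻¹ = 1 − π`.
* **`exists_cmPrimaryDecomposition_rat_two`** — for `W/ℚ` elliptic with `j = −3375`: `π`, `r ∈ 2ℤ₂` (`r² = r − 2`), and subgroups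
  `C₁, C₂ ≤ W.geomPrimaryTorsion 2` (where `π` acts as `r`, resp. `1 − r`) with `C₁ ⊓ C₂ = ⊥`, `C₁ ⊔ C₂ = ⊤`, `C₁ ≠ ⊥ ≠ C₂`; every
  `σ ∈ Γ_ℚ` satisfies `σπσ⁻¹ = π` or `σπσ⁻¹ = 1 − π`; in the first case `σC₁ = C₁`, `σC₂ = C₂`, in the second `σC₁ ⊆ C₂`, `σC₂ ⊆ C₁`;
  and a `σ` of the second kind exists.

References: [SilvermanATAEC1994] II §2 Thm. 2.2(b), App. A §3; K. Rubin, LNM 1716 §2; B. Gross, *Arithmetic on Elliptic Curves with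
Complex Multiplication*, LNM 776 (1980), §§3–4 (the action of complex conjugation on `𝔭`-torsion).
-/

noncomputable section

open scoped Classical

set_option linter.dupNamespace false
set_option autoImplicit false

namespace Summit.BirchSwinnertonDyer.BirchSwinnertonDyer.Theorems.PrintCf2.CMPrimes

section Rat

open WeierstrassCurve Literature.NumberTheory.EllipticCurves Field

/-- **`π ∉ End_ℚ(E)`**: an endomorphism with `π² = π − 2` of an elliptic curve over `ℚ` is not `ℚ`-rational (it is not an integer —
`n² − n + 2 = 0` has no solution in `ℤ` — and `End_ℚ(E) = ℤ`, the tree's `not_hasRationalCM_holds`).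
[cite: SilvermanATAEC1994, II §2 Thm. 2.2(b) with Remark II.2.2.2] -/
theorem cmEndo_not_mem_endRing_rat (W : WeierstrassCurve ℚ) [W.IsElliptic] {π : AddMonoid.End W.geomPoints}
    (hπ : π ∈ W.geomEndRing) (hrel : π * π = π - 2) : π ∉ W.endRing := by
  intro hend
  refine not_hasRationalCM_holds W ⟨π, hend, fun n hn ↦ ?_⟩
  -- `π = n` would give `n² − n + 2 = 0` in `End_{ℚ̄}(E)`, hence in `ℤ`
  haveI := charZero_geomEndRing W
  letI : CommRing W.geomEndRing :=
    { (inferInstance : Ring W.geomEndRing) with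
      mul_comm := fun x y ↦ Subtype.ext (W.geomEndRing_comm_holds _ _ x.2 y.2) }
  have h : ((n * n - n + 2 : ℤ) : W.geomEndRing) = 0 := by
    have hx : (⟨π, hπ⟩ : W.geomEndRing) = (n : W.geomEndRing) := Subtype.ext (by push_cast; exact hn)
    have hrel' : (⟨π, hπ⟩ : W.geomEndRing) * ⟨π, hπ⟩ = ⟨π, hπ⟩ - 2 := Subtype.ext (by push_cast; exact hrel)
    rw [hx] at hrel'
    push_cast
    linear_combination hrel'
  have h' : (n * n - n + 2 : ℤ) = 0 := by exact_mod_cast h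
  nlinarith [sq_nonneg (2 * n - 1)]

/-- **Some `σ ∈ Γ_ℚ` conjugates `π` to `π̄ = 1 − π`** (the automorphisms moving `√−7`, e.g. complex conjugation): `π` is not
`Γ_ℚ`-equivariant (`cmEndo_not_mem_endRing_rat`), and a non-commuting `σ` has `σπσ⁻¹ = 1 − π` by the dichotomy `conj_cmEndo_eq_or`.
[cite: SilvermanATAEC1994, II §2 Thm. 2.2(b) with Remark II.2.2.2] -/
theorem exists_conj_cmEndo_eq_one_sub (W : WeierstrassCurve ℚ) [W.IsElliptic] {π : AddMonoid.End W.geomPoints}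
    (hπ : π ∈ W.geomEndRing) (hrel : π * π = π - 2) :
    ∃ σ : absoluteGaloisGroup ℚ,
      DistribMulAction.toAddMonoidEnd (absoluteGaloisGroup ℚ) W.geomPoints σ * π *
        DistribMulAction.toAddMonoidEnd (absoluteGaloisGroup ℚ) W.geomPoints σ⁻¹ = 1 - π := by
  by_contra hno
  push Not at hno
  refine cmEndo_not_mem_endRing_rat W hπ hrel (Subring.mem_inf.2 ⟨hπ, (W.mem_equivariantSubring_iff π).2 fun σ P ↦ ?_⟩)
  have h := (conj_cmEndo_eq_or W hπ hrel σ).resolve_right (hno σ)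
  have h' := congrArg (fun f : AddMonoid.End W.geomPoints ↦ f (σ • P)) h
  simp only [toAddMonoidEnd_mul_mul_toAddMonoidEnd_inv_apply, inv_smul_smul] at h'
  exact h'.symm

/-- **THE CM-PRIME DECOMPOSITION OVER `ℚ̄` WITH THE COMPLEX-CONJUGATION SWAP.** `W/ℚ` elliptic, `j = −3375`: `π ∈ End_{ℚ̄}(E)`
(`π² = π − 2`, `#ker π = #ker π̄ = 2`), the root `r ∈ 2ℤ₂`, and `C₁ = E[𝔭^∞]`, `C₂ = E[𝔭̄^∞] ≤ E[2^∞](ℚ̄)` with `C₁ ⊓ C₂ = ⊥`,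
`C₁ ⊔ C₂ = ⊤`, `C₁ ≠ ⊥ ≠ C₂`; every `σ ∈ Γ_ℚ` either commutes with `π` and preserves `C₁`, `C₂`, or conjugates `π` to `1 − π` and maps
`C₁` into `C₂` and `C₂` into `C₁`; the second kind exists. [cite: SilvermanATAEC1994, II §2 Thm. 2.2(b) and App. A §3 (row D = -7)] -/
theorem exists_cmPrimaryDecomposition_rat_two (W : WeierstrassCurve ℚ) [W.IsElliptic] (hj : W.j = -3375) :
    ∃ (π : AddMonoid.End W.geomPoints) (r : ℤ_[2]) (C₁ C₂ : AddSubgroup (W.geomPrimaryTorsion 2)),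
      π ∈ W.geomEndRing ∧ π * π = π - 2 ∧
      Nat.card (π : W.geomPoints →+ W.geomPoints).ker = 2 ∧
      Nat.card ((1 - π : AddMonoid.End W.geomPoints) : W.geomPoints →+ W.geomPoints).ker = 2 ∧
      r * r = r - 2 ∧ ‖r‖ < 1 ∧
      (∀ x, x ∈ C₁ ↔ ∀ (k : ℕ) (N : ℤ), 2 ^ k • x = 0 →
        ((N : ℤ_[2]) - r) ∈ (Ideal.span {(2 : ℤ_[2]) ^ k} : Ideal ℤ_[2]) →
          π (x : W.geomPoints) = N • (x : W.geomPoints)) ∧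
      (∀ x, x ∈ C₂ ↔ ∀ (k : ℕ) (N : ℤ), 2 ^ k • x = 0 →
        ((N : ℤ_[2]) - (1 - r)) ∈ (Ideal.span {(2 : ℤ_[2]) ^ k} : Ideal ℤ_[2]) →
          π (x : W.geomPoints) = N • (x : W.geomPoints)) ∧
      C₁ ⊓ C₂ = ⊥ ∧ C₁ ⊔ C₂ = ⊤ ∧ C₁ ≠ ⊥ ∧ C₂ ≠ ⊥ ∧
      (∀ σ : absoluteGaloisGroup ℚ,
        (DistribMulAction.toAddMonoidEnd (absoluteGaloisGroup ℚ) W.geomPoints σ * π *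
            DistribMulAction.toAddMonoidEnd (absoluteGaloisGroup ℚ) W.geomPoints σ⁻¹ = π ∧
          (∀ x ∈ C₁, σ • x ∈ C₁) ∧ (∀ x ∈ C₂, σ • x ∈ C₂)) ∨
        (DistribMulAction.toAddMonoidEnd (absoluteGaloisGroup ℚ) W.geomPoints σ * π *
            DistribMulAction.toAddMonoidEnd (absoluteGaloisGroup ℚ) W.geomPoints σ⁻¹ = 1 - π ∧
          (∀ x ∈ C₁, σ • x ∈ C₂) ∧ (∀ x ∈ C₂, σ • x ∈ C₁))) ∧
      (∃ σ : absoluteGaloisGroup ℚ,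
        DistribMulAction.toAddMonoidEnd (absoluteGaloisGroup ℚ) W.geomPoints σ * π *
            DistribMulAction.toAddMonoidEnd (absoluteGaloisGroup ℚ) W.geomPoints σ⁻¹ = 1 - π) := by
  haveI : Fact (Nat.Prime 2) := ⟨Nat.prime_two⟩
  obtain ⟨π, hπ, hrel, hker, hker'⟩ := exists_cmEndo_of_j_eq_neg3375 W hj
  obtain ⟨r, hr, hrlt, hsum, hprod, hunit⟩ := exists_padicInt_two_root
  set M := ↥(W.geomPrimaryTorsion 2) with hM_def
  have hmem : ∀ x : M, π (x : W.geomPoints) ∈ W.geomPrimaryTorsion 2 := fun x ↦ by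
    obtain ⟨k, hk⟩ := (AddCommGroup.mem_primaryComponent).mp x.2
    exact (AddCommGroup.mem_primaryComponent).mpr ⟨k, by rw [← map_nsmul, hk, map_zero]⟩
  let πM : M →+ M :=
    { toFun := fun x ↦ ⟨π (x : W.geomPoints), hmem x⟩
      map_zero' := Subtype.ext (by simp)
      map_add' := fun x y ↦ Subtype.ext (by
        change π ((x : W.geomPoints) + y) = π x + π y
        rw [map_add]) }
  have hπM : ∀ x : M, ((πM x : M) : W.geomPoints) = π (x : W.geomPoints) := fun _ ↦ rfl
  have hMp : ∀ x : M, ∃ k : ℕ, 2 ^ k • x = 0 := fun x ↦ by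
    obtain ⟨k, hk⟩ := (AddCommGroup.mem_primaryComponent).mp x.2
    exact ⟨k, Subtype.ext (by rw [AddSubmonoidClass.coe_nsmul, ZeroMemClass.coe_zero]; exact hk)⟩
  have hπMrel : ∀ x : M, πM (πM x) = (1 : ℤ) • πM x - (2 : ℤ) • x := fun x ↦
    Subtype.ext (by
      rw [AddSubgroupClass.coe_sub, AddSubgroupClass.coe_zsmul, AddSubgroupClass.coe_zsmul, hπM, hπM, one_zsmul,
        cmEndo_apply_apply W hrel]
      norm_cast)
  have hsum' : r + (1 - r) = ((1 : ℤ) : ℤ_[2]) := by push_cast; ring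
  have hprod' : r * (1 - r) = ((2 : ℤ) : ℤ_[2]) := by exact_mod_cast hprod
  obtain ⟨C₁, C₂, hC₁, hC₂, hinf, hsup, hstab, hswap⟩ :=
    exists_eigenDecomposition (p := 2) hMp πM hπMrel hsum' hprod' hunit
  have htr : ∀ (ρ : ℤ_[2]) (x : M),
      (∀ (k : ℕ) (N : ℤ), 2 ^ k • x = 0 →
        ((N : ℤ_[2]) - ρ) ∈ (Ideal.span {(2 : ℤ_[2]) ^ k} : Ideal ℤ_[2]) → πM x = N • x) ↔
      (∀ (k : ℕ) (N : ℤ), 2 ^ k • x = 0 →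
        ((N : ℤ_[2]) - ρ) ∈ (Ideal.span {(2 : ℤ_[2]) ^ k} : Ideal ℤ_[2]) →
          π (x : W.geomPoints) = N • (x : W.geomPoints)) := fun ρ x ↦ by
    refine forall_congr' fun k ↦ forall_congr' fun N ↦ forall_congr' fun _ ↦ forall_congr' fun _ ↦ ?_
    rw [Subtype.ext_iff, hπM, AddSubgroupClass.coe_zsmul]
  have h1π : ∀ P, (1 - π : AddMonoid.End W.geomPoints) P = P - π P := fun P ↦ by
    change ((1 : AddMonoid.End W.geomPoints) : _ →+ _) P - (π : _ →+ _) P = _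
    simp
  refine ⟨π, r, C₁, C₂, hπ, hrel, hker, hker', hr, hrlt,
    fun x ↦ (hC₁ x).trans (htr r x), fun x ↦ (hC₂ x).trans (htr (1 - r) x), hinf, hsup, ?_, ?_, ?_,
    exists_conj_cmEndo_eq_one_sub W hπ hrel⟩
  · -- `C₁ ≠ ⊥`: `E[𝔭] = ker π ⊆ C₁`
    obtain ⟨P, hP, hP0⟩ : ∃ P : W.geomPoints, π P = 0 ∧ P ≠ 0 := by
      by_contra hno
      push Not at hno
      have : (π : W.geomPoints →+ W.geomPoints).ker = ⊥ := by
        rw [eq_bot_iff]; intro P hPk; exact (AddSubgroup.mem_bot).mpr (hno P hPk)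
      rw [this, AddSubgroup.card_bot] at hker
      exact absurd hker (by norm_num)
    have h2P : 2 • P = 0 := by
      have h := cmEndo_apply_apply W hrel P
      rw [hP, map_zero, zero_sub, eq_comm, neg_eq_zero] at h
      exact h
    have hPM : P ∈ W.geomPrimaryTorsion 2 := (AddCommGroup.mem_primaryComponent).mpr ⟨1, by rw [pow_one, h2P]⟩
    intro hbot
    have hx : (⟨P, hPM⟩ : M) ∈ C₁ := by
      rw [hC₁]
      refine eigen_of_level πM r (k := 1) (N₁ := 0)
        (Subtype.ext (by rw [AddSubmonoidClass.coe_nsmul, ZeroMemClass.coe_zero, pow_one]; exact h2P)) ?_ (Subtype.ext ?_)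
      · rw [Int.cast_zero, zero_sub, Ideal.neg_mem_iff, Ideal.mem_span_singleton, pow_one]
        exact (PadicInt.norm_lt_one_iff_dvd r).mp hrlt
      · rw [hπM, zero_zsmul]; exact hP
    rw [hbot, AddSubgroup.mem_bot] at hx
    exact hP0 (congrArg Subtype.val hx)
  · -- `C₂ ≠ ⊥`: `E[𝔭̄] = ker (1 − π) ⊆ C₂`
    obtain ⟨P, hP, hP0⟩ : ∃ P : W.geomPoints, π P = P ∧ P ≠ 0 := by
      by_contra hno
      push Not at hno
      have : ((1 - π : AddMonoid.End W.geomPoints) : W.geomPoints →+ W.geomPoints).ker = ⊥ := by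
        rw [eq_bot_iff]; intro P hPk
        have hPk' : P - π P = 0 := by rw [← h1π]; exact hPk
        exact (AddSubgroup.mem_bot).mpr (hno P (sub_eq_zero.mp hPk').symm)
      rw [this, AddSubgroup.card_bot] at hker'
      exact absurd hker' (by norm_num)
    have h2P : 2 • P = 0 := by
      have h := cmEndo_apply_apply W hrel P
      rw [hP, hP, eq_comm, sub_eq_self] at h
      exact h
    have hPM : P ∈ W.geomPrimaryTorsion 2 := (AddCommGroup.mem_primaryComponent).mpr ⟨1, by rw [pow_one, h2P]⟩
    intro hbot
    have hx : (⟨P, hPM⟩ : M) ∈ C₂ := by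
      rw [hC₂]
      refine eigen_of_level πM (1 - r) (k := 1) (N₁ := 1)
        (Subtype.ext (by rw [AddSubmonoidClass.coe_nsmul, ZeroMemClass.coe_zero, pow_one]; exact h2P)) ?_ (Subtype.ext ?_)
      · rw [Int.cast_one, sub_sub_cancel, Ideal.mem_span_singleton, pow_one]
        exact (PadicInt.norm_lt_one_iff_dvd r).mp hrlt
      · rw [hπM, one_zsmul]; exact hP
    rw [hbot, AddSubgroup.mem_bot] at hx
    exact hP0 (congrArg Subtype.val hx)
  · -- the dichotomy `σπσ⁻¹ ∈ {π, 1 − π}` and its effect on the summands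
    intro σ
    rcases conj_cmEndo_eq_or W hπ hrel σ with h | h
    · refine Or.inl ⟨h, hstab (DistribMulAction.toAddMonoidEnd (absoluteGaloisGroup ℚ) M σ) fun x ↦ Subtype.ext ?_⟩
      change σ • π (x : W.geomPoints) = π (σ • (x : W.geomPoints))
      have h' := congrArg (fun f : AddMonoid.End W.geomPoints ↦ f (σ • (x : W.geomPoints))) h
      simp only [toAddMonoidEnd_mul_mul_toAddMonoidEnd_inv_apply, inv_smul_smul] at h'
      exact h'
    · refine Or.inr ⟨h, hswap (DistribMulAction.toAddMonoidEnd (absoluteGaloisGroup ℚ) M σ) fun x ↦ Subtype.ext ?_⟩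
      change π (σ • (x : W.geomPoints)) = ((((1 : ℤ) • (σ • x) - (σ • πM x) : M)) : W.geomPoints)
      rw [AddSubgroupClass.coe_sub, AddSubgroupClass.coe_zsmul, one_zsmul, primaryComponent.coe_smul,
        primaryComponent.coe_smul, hπM]
      have h' := congrArg (fun f : AddMonoid.End W.geomPoints ↦ f (σ • (x : W.geomPoints))) h
      simp only [toAddMonoidEnd_mul_mul_toAddMonoidEnd_inv_apply, inv_smul_smul] at h'
      rw [h1π] at h'
      rw [h', sub_sub_cancel]

end Rat

end Summit.BirchSwinnertonDyer.BirchSwinnertonDyer.Theorems.PrintCf2.CMPrimes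

end
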